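import Summits.Ventures.PercRepro.ProfilePointedCircuitClassesGeneric
import Summits.Ventures.PercRepro.ProfilePointedCircuitClassesGenericTwo
import Summits.Ventures.PercRepro.ProfilePointedCircuitClassesFiveTop
import Summits.Ventures.PercRepro.ProfilePointedCircuitClassesSevenF

/-!
# PercRepro — THE BOTTOM-LEVEL PER-CIRCUIT CLAIM AT NULLITY 6: THE CO-RANK-7 TOP THRESHOLD AT NULLITY `≤ 6` MODULO
THE TWO PER-SET IN–OUT INEQUALITIES AT THE BOTTOM OF NULLITY 5 (p5, gen 42; `proofs/P5-GM1.md` §63)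

One nullity up from §53 / §61.  On a matroid with `#E = ρ(E) + 6`, `ρ(E) ≥ 8`, the per-circuit claim
`γ_C(6) ≤ γ_C(n − 7)` splits by the size of the class exactly as at nullity `5`: `#C ≥ 7` empty, `#C ∈ {4, 5, 6}`
the generic kernel theorems (`gammaC_le_of_card_eq_nullity_sub_two`, `…_sub_one`, `…_nullity`), `#C = 1` the
weak step `P_5 ≤ P_6` of nullity `5` on the minor `N ／ x ∖ w` (unconditional since gen 41,
`biIndep_step_five_of_nullity_five`), `#C = 0` empty — and TWO classes that reduce (`gammaC_le_iff_thruCount_le`)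
to per-set refinements of Theorem A's step ONE NULLITY DOWN, both census-true and both OPEN:

* `#C = 2` ⇔ the per-point inequality `in_5(e) ≤ out_6(e)` on the nullity-5 minor `N ／ x ∖ w₁`
  (the CONJECTURE def `InOutBottomFive`; §62(1): 0 failures on 56,572 / 32,438 / 14,058 twin-free points at
  `n = 12 / 13 / 14`; §63: its census-clean fractional charging certificate at `ρ = 7`);
* `#C = 3` ⇔ the per-pair inequality `in_5(S) ≤ in_{n−6}(S) = out_6(S)` for an independent pair `S` on the
  nullity-5 minor (the CONJECTURE def `InOutPairBottomFive`; §53(f)(2): 0 failures on 159,267,… instances of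
  `(A_S)`, `#S = 2`, on 410,700 random nullity-5 matroids at `n = 12`; its SHARP form is false, §53 ADD 5).

Neither def is asserted; both are carried as hypotheses.  Consequences: Theorem A's step at the level `6` on every
matroid of nullity `6` and rank `≥ 8` (`biIndep_step_six_of_nullity_six_of_inout`) and **the co-rank-7 top
threshold `(I_{ρ−1})` on every finite matroid with at most six more points than its rank, rank `≥ 7`**
(`thresholdIneq_seven_top_of_nullity_le_six_of_inout`) — modulo the two defs.  Also the generic helpers
`circuit_facts_of_mem_class` (a demand of the class `(x, C)` makes `C + x` a circuit) and
`minor_facts_of_circuit` (ground set, size and rank of `N ／ x ∖ w`), usable at every nullity.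
-/

open scoped Matroid

namespace PercRepro.Cogirth

open Finset ThmH Skew Shadow Profile

variable {α : Type} [DecidableEq α] {N : Matroid α} [N.Finite]

section SixTop

/-- **THE PER-POINT IN–OUT INEQUALITY AT THE BOTTOM OF NULLITY 5** (a `Prop`; a CONJECTURE, NOT asserted; §62(1)): on
every finite matroid with `#E = ρ(E) + 5` and `ρ(E) ≥ 7`, for every point `e`, `in_5(e) ≤ out_6(e)` — the
bi-independent `5`-sets containing `e` are at most the bi-independent `6`-sets avoiding `e`.  It is `(A_e)` at the
bottom of nullity `5`, the per-set refinement of Theorem A's step for `S = {e}` one nullity above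
`InOutBottomFour` (a theorem since gen 41); 0 failures on 56,572 / 32,438 / 14,058 twin-free points of random
nullity-5 matroids at `n = 12 / 13 / 14` (§62(1)); at `ρ = 7` its fractional charging certificate (§63) is
census-clean on 7,532,480 demands; no proof yet. -/
def InOutBottomFive (α : Type) [DecidableEq α] : Prop :=
  ∀ (N : Matroid α) [N.Finite] (e : α), e ∈ gr N → (gr N).card = rk N (gr N) + 5 → 7 ≤ rk N (gr N) →
    inCount N 5 e ≤ outCount N 6 e

/-- **THE PER-PAIR IN–OUT INEQUALITY AT THE BOTTOM OF NULLITY 5** (a `Prop`; a CONJECTURE, NOT asserted; §53(b),(f)):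
on every finite matroid with `#E = ρ(E) + 5` and `ρ(E) ≥ 7`, for every pair `S ⊆ E`, the bi-independent `5`-sets
containing `S` are at most the bi-independent `(n − 6)`-sets containing `S` (by complementation: the bi-independent
`6`-sets avoiding `S`) — `(A_S)` for `#S = 2` at the bottom of nullity `5`, the class `#C = 3` of nullity `6`
(`gammaC_le_iff_thruCount_le`).  0 failures on 159,267,… `(S, k)` instances at `(n, ν) = (12, 5)` (§53(f)(2));
its sharp form `(n − k − 2)·in_k(S) ≤ (k − 1)·out_{k+1}(S)` is FALSE (§53 ADD 5: `in_5(S) = 72`, `out_6(S) = 80`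
on a GF(3) instance); a dependent `S` makes both sides `0`. -/
def InOutPairBottomFive (α : Type) [DecidableEq α] : Prop :=
  ∀ (N : Matroid α) [N.Finite] (S : Finset α), S ⊆ gr N → S.card = 2 → (gr N).card = rk N (gr N) + 5 →
    7 ≤ rk N (gr N) → thruCount N 5 S ≤ thruCount N ((gr N).card - 6) S

/-- A demand of the class `(x, C)` at any level makes `C + x` a circuit with `x` a non-loop: `C ⊆ W`, `C ⊆ E`,
`x ∈ E`, `x ∉ C`, `C` independent, `x ∈ cl C`, `x ∉ cl(C − c)` for every `c ∈ C`, and `ρ{x} = 1`. -/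
theorem circuit_facts_of_mem_class {k : ℕ} {x : α} {C W : Finset α}
    (hW : W ∈ (biIndepSets N k).filter (fun W => x ∉ W ∧ x ∈ clF N W ∧ fundC N W x = C)) :
    C ⊆ W ∧ C ⊆ gr N ∧ x ∈ gr N ∧ x ∉ C ∧ rk N C = C.card ∧ x ∈ clF N C ∧
      (∀ c ∈ C, x ∉ clF N (C.erase c)) ∧ rk N {x} = 1 := by
  rw [mem_filter, mem_biIndepSets] at hW
  obtain ⟨⟨hWg, _, hWrk, hWcompl⟩, hxW, hxcl, hfund⟩ := hW
  have hCW : C ⊆ W := hfund ▸ fundC_subset W x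
  have hxg : x ∈ gr N := clF_subset_gr W hxcl
  refine ⟨hCW, hCW.trans hWg, hxg, fun h => hxW (hCW h), rk_eq_card_of_subset_of_rk_eq_card hCW hWrk, ?_, ?_, ?_⟩
  · have h := mem_clF_sdiff_of_forall_notMem_fundC hxg hWg hWrk hxcl (W \ C) sdiff_subset
      (fun w hw => by rw [hfund]; exact (mem_sdiff.1 hw).2)
    rwa [Finset.sdiff_sdiff_eq_self hCW] at h
  · intro c hc hxc
    have hcf : c ∈ fundC N W x := by rw [hfund]; exact hc
    unfold fundC at hcf
    rw [mem_filter] at hcf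
    exact hcf.2 (mem_clF_of_subset (erase_subset_erase c hCW) hxc)
  · have h := rk_eq_card_of_subset_of_rk_eq_card (singleton_subset_iff.2 (mem_sdiff.2 ⟨hxg, hxW⟩)) hWcompl
    rwa [card_singleton] at h

/-- The minor `N° := N ／ x ∖ w` of a circuit `C + x` (`w ∈ C`, `x` a non-loop): its ground set is `E − x − w`, it has
`n − 2` points and rank `ρ(E) − 1` (`w` is not a coloop of `N`, as `w ∈ cl((C − w) + x)`). -/
theorem minor_facts_of_circuit {x : α} {C : Finset α} (hC : C ⊆ gr N) (hx : x ∈ gr N) (hxC : x ∉ C)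
    (hrk : rk N C = C.card) (hxcl : x ∈ clF N C) (hfund : ∀ c ∈ C, x ∉ clF N (C.erase c)) (hx1 : rk N {x} = 1)
    {w : α} (hw : w ∈ C) :
    gr ((N ／ ({x} : Set α)) ＼ ({w} : Set α)) = ((gr N).erase x).erase w ∧
    (gr ((N ／ ({x} : Set α)) ＼ ({w} : Set α))).card = (gr N).card - 2 ∧
    rk ((N ／ ({x} : Set α)) ＼ ({w} : Set α)) (gr ((N ／ ({x} : Set α)) ＼ ({w} : Set α))) =
      rk N (gr N) - 1 := by
  have hwg : w ∈ gr N := hC hw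
  have hxw : x ≠ w := fun h => hxC (h ▸ hw)
  have hgr₀ : gr ((N ／ ({x} : Set α)) ＼ ({w} : Set α)) = ((gr N).erase x).erase w := by
    rw [gr_delete', gr_contract']
  have hxind : N.Indep ({x} : Set α) := by
    have := indep_of_rk_eq_card' (M := N) (X := {x}) (by rw [hx1, card_singleton])
    simpa using this
  have hrk₀ : ∀ X : Finset α, X ⊆ ((gr N).erase x).erase w →
      rk ((N ／ ({x} : Set α)) ＼ ({w} : Set α)) X + 1 = rk N (insert x X) := by
    intro X hX
    have hX' : X ⊆ (gr (N ／ ({x} : Set α))).erase w := by rw [gr_contract']; exact hX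
    have hX'' : X ⊆ (gr N).erase x := hX.trans (erase_subset _ _)
    rw [rk_delete hX', rk_contract_add_one hxind hX'']
  have hcard₀ : (((gr N).erase x).erase w).card = (gr N).card - 2 := by
    rw [card_erase_of_mem (mem_erase.2 ⟨fun h => hxw h.symm, hwg⟩), card_erase_of_mem hx]
    omega
  refine ⟨hgr₀, by rw [hgr₀, hcard₀], ?_⟩
  rw [hgr₀]
  have h := hrk₀ _ (Subset.refl _)
  have e : insert x (((gr N).erase x).erase w) = (gr N).erase w := by
    ext a
    simp only [mem_insert, mem_erase]
    constructor
    · rintro (rfl | ⟨haw, _, hag⟩)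
      · exact ⟨hxw, hx⟩
      · exact ⟨haw, hag⟩
    · rintro ⟨haw, hag⟩
      by_cases hax : a = x
      · exact Or.inl hax
      · exact Or.inr ⟨haw, hax, hag⟩
  -- `w` is not a coloop: `w ∈ cl((C − w) + x) ⊆ cl(E − w)`
  have hwcl : w ∈ clF N (insert x (C.erase w)) :=
    mem_clF_insert_erase_of_circuit hC hx hrk hxcl hw (hfund w hw)
  have hwcl' : w ∈ clF N ((gr N).erase w) := by
    refine mem_clF_of_subset ?_ hwcl
    intro a ha
    rw [mem_insert] at ha
    rcases ha with rfl | ha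
    · exact mem_erase.2 ⟨hxw, hx⟩
    · rw [mem_erase] at ha
      exact mem_erase.2 ⟨ha.1, hC ha.2⟩
  have h2 : rk N (insert w ((gr N).erase w)) = rk N ((gr N).erase w) := by
    rw [rk_insert_eq hwg (erase_subset w (gr N)), if_pos hwcl']
  rw [insert_erase hwg] at h2
  rw [e, ← h2] at h
  omega

/-- THE CLASS `#C = 1` AT NULLITY 6 (`x ∥ w`): the parallel bridge with the weak step `P_5 ≤ P_6` of the nullity-5
minor `N ／ x ∖ w` (rank `ρ − 1 ≥ 7`, a theorem: `biIndep_step_five_of_nullity_five`). -/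
theorem gammaC_six_le_of_card_eq_one (hn : (gr N).card = rk N (gr N) + 6) (hR : 8 ≤ rk N (gr N))
    (x : α) {C : Finset α} (hC : C.card = 1) : gammaC N 6 x C ≤ gammaC N ((gr N).card - 7) x C := by
  obtain ⟨w, rfl⟩ := card_eq_one.1 hC
  rcases ((biIndepSets N 6).filter (fun W => x ∉ W ∧ x ∈ clF N W ∧ fundC N W x = {w})).eq_empty_or_nonempty
    with hemp | ⟨W₀, hW₀⟩
  · unfold gammaC
    rw [hemp, card_empty]
    exact Nat.zero_le _
  obtain ⟨-, hCg, hxg, hxC, hrk, hxcl, hfund, hx1⟩ := circuit_facts_of_mem_class hW₀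
  have hwg : w ∈ gr N := hCg (mem_singleton_self w)
  have hxw : x ≠ w := fun h => hxC (h ▸ mem_singleton_self w)
  have hw1 : rk N {w} = 1 := by rw [hrk, card_singleton]
  have hxe : x ∉ clF N ∅ := by
    have := hfund w (mem_singleton_self w)
    rwa [erase_singleton] at this
  obtain ⟨_, hcard₀, hrkg₀⟩ :=
    minor_facts_of_circuit hCg hxg hxC hrk hxcl hfund hx1 (mem_singleton_self w)
  have e : (gr N).card - 7 = (gr N).card - 1 - 6 := by omega
  rw [e]
  apply gammaC_le_of_card_eq_one_of_step hwg hxg hxw hw1 hxcl hxe (by norm_num) (by omega)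
  have hn₀ : (gr ((N ／ ({x} : Set α)) ＼ ({w} : Set α))).card =
      rk ((N ／ ({x} : Set α)) ＼ ({w} : Set α)) (gr ((N ／ ({x} : Set α)) ＼ ({w} : Set α))) + 5 := by
    rw [hcard₀, hrkg₀]
    omega
  have hR₀ : 7 ≤ rk ((N ／ ({x} : Set α)) ＼ ({w} : Set α)) (gr ((N ／ ({x} : Set α)) ＼ ({w} : Set α))) := by
    rw [hrkg₀]
    omega
  have hstep := biIndep_step_five_of_nullity_five hn₀ hR₀
  have h6 : 6 ≤ (gr ((N ／ ({x} : Set α)) ＼ ({w} : Set α))).card - 5 := by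
    rw [hcard₀]
    omega
  have h66 : 6 * (biIndepSets ((N ／ ({x} : Set α)) ＼ ({w} : Set α)) 5).card ≤
      6 * (biIndepSets ((N ／ ({x} : Set α)) ＼ ({w} : Set α)) 6).card :=
    le_trans (Nat.mul_le_mul_right _ h6) hstep
  have e1 : (6 : ℕ) - 1 = 5 := by norm_num
  rw [e1]
  exact Nat.le_of_mul_le_mul_left h66 (by norm_num)

/-- THE CLASS `#C = 2` AT NULLITY 6 MODULO `InOutBottomFive` (the triangle `{x, w₁, w₂}`): the triangle bridge with
`in_5(w₂) ≤ out_6(w₂)` on the nullity-5 minor `N ／ x ∖ w₁` (rank `ρ − 1 ≥ 7`). -/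
theorem gammaC_six_le_of_card_eq_two_of_inout (hio : InOutBottomFive α)
    (hn : (gr N).card = rk N (gr N) + 6) (hR : 8 ≤ rk N (gr N))
    (x : α) {C : Finset α} (hC : C.card = 2) : gammaC N 6 x C ≤ gammaC N ((gr N).card - 7) x C := by
  obtain ⟨w₁, w₂, hw12, rfl⟩ := card_eq_two.1 hC
  rcases ((biIndepSets N 6).filter (fun W => x ∉ W ∧ x ∈ clF N W ∧ fundC N W x = {w₁, w₂})).eq_empty_or_nonempty
    with hemp | ⟨W₀, hW₀⟩
  · unfold gammaC
    rw [hemp, card_empty]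
    exact Nat.zero_le _
  obtain ⟨-, hCg, hxg, hxC, hrk, hxcl, hfund, hx1⟩ := circuit_facts_of_mem_class hW₀
  have hw₂g : w₂ ∈ gr N := hCg (mem_insert_of_mem (mem_singleton_self _))
  have hxw₂ : x ≠ w₂ := fun h => hxC (h ▸ mem_insert_of_mem (mem_singleton_self _))
  have hrk2 : rk N {w₁, w₂} = 2 := by rw [hrk, card_pair hw12]
  have hxn2 : x ∉ clF N {w₂} := by
    have h := hfund w₁ (mem_insert_self _ _)
    have e : ({w₁, w₂} : Finset α).erase w₁ = {w₂} := by
      rw [erase_insert]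
      rw [mem_singleton]; exact hw12
    rwa [e] at h
  have hxn1 : x ∉ clF N {w₁} := by
    have h := hfund w₂ (mem_insert_of_mem (mem_singleton_self _))
    have e : ({w₁, w₂} : Finset α).erase w₂ = {w₁} := by
      rw [erase_insert_of_ne hw12, erase_singleton, insert_empty]
    rwa [e] at h
  obtain ⟨hgr₀, hcard₀, hrkg₀⟩ :=
    minor_facts_of_circuit hCg hxg hxC hrk hxcl hfund hx1 (mem_insert_self w₁ {w₂})
  have e : (gr N).card - 7 = (gr N).card - 1 - 6 := by omega
  rw [e]
  apply gammaC_le_of_card_eq_two_of_inout' hw12 hCg hxg hxC hrk2 hxcl hxn2 hxn1 (by norm_num) (by omega)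
  have hw₂g₀ : w₂ ∈ gr ((N ／ ({x} : Set α)) ＼ ({w₁} : Set α)) := by
    rw [hgr₀]
    exact mem_erase.2 ⟨hw12.symm, mem_erase.2 ⟨fun h => hxw₂ h.symm, hw₂g⟩⟩
  have hn₀ : (gr ((N ／ ({x} : Set α)) ＼ ({w₁} : Set α))).card =
      rk ((N ／ ({x} : Set α)) ＼ ({w₁} : Set α)) (gr ((N ／ ({x} : Set α)) ＼ ({w₁} : Set α))) + 5 := by
    rw [hcard₀, hrkg₀]
    omega
  have hR₀ : 7 ≤ rk ((N ／ ({x} : Set α)) ＼ ({w₁} : Set α)) (gr ((N ／ ({x} : Set α)) ＼ ({w₁} : Set α))) := by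
    rw [hrkg₀]
    omega
  have e1 : (6 : ℕ) - 1 = 5 := by norm_num
  rw [e1]
  exact hio _ w₂ hw₂g₀ hn₀ hR₀

/-- THE CLASS `#C = 3` AT NULLITY 6 MODULO `InOutPairBottomFive`: by the reduction `gammaC_le_iff_thruCount_le` the
claim is `thru_5(C − w) ≤ thru_{n−8}(C − w)` on the nullity-5 minor `N ／ x ∖ w` (`n − 8 = n° − 6`), i.e. `(A_S)`
for the pair `S = C − w`. -/
theorem gammaC_six_le_of_card_eq_three_of_inout_pair (hio : InOutPairBottomFive α)
    (hn : (gr N).card = rk N (gr N) + 6) (hR : 8 ≤ rk N (gr N))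
    (x : α) {C : Finset α} (hC : C.card = 3) : gammaC N 6 x C ≤ gammaC N ((gr N).card - 7) x C := by
  rcases ((biIndepSets N 6).filter (fun W => x ∉ W ∧ x ∈ clF N W ∧ fundC N W x = C)).eq_empty_or_nonempty
    with hemp | ⟨W₀, hW₀⟩
  · unfold gammaC
    rw [hemp, card_empty]
    exact Nat.zero_le _
  obtain ⟨-, hCg, hxg, hxC, hrk, hxcl, hfund, hx1⟩ := circuit_facts_of_mem_class hW₀
  obtain ⟨w, hw⟩ : C.Nonempty := card_pos.1 (by omega)
  obtain ⟨hgr₀, hcard₀, hrkg₀⟩ := minor_facts_of_circuit hCg hxg hxC hrk hxcl hfund hx1 hw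
  have e : (gr N).card - 7 = (gr N).card - 1 - 6 := by omega
  rw [e, gammaC_le_iff_thruCount_le hCg hxg hxC hrk hxcl hfund hw (by norm_num) (by omega)]
  have hSg : C.erase w ⊆ gr ((N ／ ({x} : Set α)) ＼ ({w} : Set α)) := by
    rw [hgr₀]
    intro a ha
    rw [mem_erase] at ha
    exact mem_erase.2 ⟨ha.1, mem_erase.2 ⟨fun h => hxC (h ▸ ha.2), hCg ha.2⟩⟩
  have hScard : (C.erase w).card = 2 := by rw [card_erase_of_mem hw, hC]
  have hn₀ : (gr ((N ／ ({x} : Set α)) ＼ ({w} : Set α))).card =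
      rk ((N ／ ({x} : Set α)) ＼ ({w} : Set α)) (gr ((N ／ ({x} : Set α)) ＼ ({w} : Set α))) + 5 := by
    rw [hcard₀, hrkg₀]
    omega
  have hR₀ : 7 ≤ rk ((N ／ ({x} : Set α)) ＼ ({w} : Set α)) (gr ((N ／ ({x} : Set α)) ＼ ({w} : Set α))) := by
    rw [hrkg₀]
    omega
  have h := hio _ (C.erase w) hSg hScard hn₀ hR₀
  rw [hcard₀] at h
  have e1 : (6 : ℕ) - 1 = 5 := by norm_num
  rw [e1]
  exact h

/-- **THE BOTTOM-LEVEL PER-CIRCUIT CLAIM AT NULLITY 6 MODULO THE TWO IN–OUT INEQUALITIES AT NULLITY 5** (§63): on a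
matroid with `#E = ρ(E) + 6` and `ρ(E) ≥ 8`, every circuit class has at least as many captured sets at the level
`n − 7` as at the level `6` — by cases on the size of the class: `#C ≥ 7` empty, `#C = 6` (`Δ ≤ 1 ≤ U`),
`#C = 5` (the uniform bound `ρ − 6`), `#C = 4` (the generic local LYM), `#C = 3` (`InOutPairBottomFive` on
`N ／ x ∖ w`), `#C = 2` (`InOutBottomFive` on `N ／ x ∖ w₁`), `#C = 1` (the nullity-5 step), `#C = 0` empty. -/
theorem gammaC_six_le_of_nullity_six_of_inout (h₁ : InOutBottomFive α) (h₂ : InOutPairBottomFive α)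
    (hn : (gr N).card = rk N (gr N) + 6) (hR : 8 ≤ rk N (gr N))
    (x : α) (C : Finset α) : gammaC N 6 x C ≤ gammaC N ((gr N).card - 7) x C := by
  rcases Nat.lt_or_ge 6 C.card with h7 | h6
  · rw [gammaC_eq_zero_of_lt_card h7]
    exact Nat.zero_le _
  · by_cases hx : x ∈ gr N
    · interval_cases hc : C.card
      · rw [gammaC_eq_zero_of_card_eq_zero hc (by norm_num) hx]
        exact Nat.zero_le _
      · exact gammaC_six_le_of_card_eq_one hn hR x hc
      · exact gammaC_six_le_of_card_eq_two_of_inout h₁ hn hR x hc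
      · exact gammaC_six_le_of_card_eq_three_of_inout_pair h₂ hn hR x hc
      · have h := gammaC_le_of_card_eq_nullity_sub_two (ν := 6) (by norm_num) hn (by omega) x (by rw [hc])
        simpa using h
      · have h := gammaC_le_of_card_eq_nullity_sub_one (ν := 6) hn (by omega) x (by norm_num) (by rw [hc])
        simpa using h
      · have h := gammaC_le_of_card_eq_nullity (ν := 6) hn (by omega) x (by rw [hc])
        simpa using h
    · have h0 : gammaC N 6 x C = 0 := by
        unfold gammaC
        rw [card_eq_zero, filter_eq_empty_iff]
        intro W _ hWC
        exact hx (clF_subset_gr W hWC.2.1)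
      rw [h0]
      exact Nat.zero_le _

/-- `κ_6(x) ≤ κ_{n−7}(x)` on every matroid of nullity `6` and rank `≥ 8`, modulo the two in–out inequalities — the
per-point form `(C_x)` of Theorem A at the level `6`, summed over the circuit classes. -/
theorem capCount_six_le_of_nullity_six_of_inout (h₁ : InOutBottomFive α) (h₂ : InOutPairBottomFive α)
    (hn : (gr N).card = rk N (gr N) + 6) (hR : 8 ≤ rk N (gr N))
    (x : α) : capCount N 6 x ≤ capCount N ((gr N).card - 7) x := by
  rw [capCount_eq_sum_gammaC, capCount_eq_sum_gammaC]
  exact sum_le_sum (fun C _ => gammaC_six_le_of_nullity_six_of_inout h₁ h₂ hn hR x C)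

/-- `out_6(x) ≤ in_7(x)` on every matroid of nullity `6` and rank `≥ 8`, modulo the two in–out inequalities (the
mirror identity `outCount_add_capCount_mirror` with `capCount_six_le_of_nullity_six_of_inout`). -/
theorem outCount_six_le_inCount_seven_of_nullity_six_of_inout (h₁ : InOutBottomFive α)
    (h₂ : InOutPairBottomFive α) (hn : (gr N).card = rk N (gr N) + 6) (hR : 8 ≤ rk N (gr N)) {x : α}
    (hx : x ∈ gr N) : outCount N 6 x ≤ inCount N 7 x := by
  have h := outCount_add_capCount_mirror (M := N) 6 hx (by omega)
  have h2 := capCount_six_le_of_nullity_six_of_inout h₁ h₂ hn hR x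
  norm_num at h
  omega

/-- **THEOREM A'S STEP AT THE LEVEL `6` ON EVERY MATROID OF NULLITY `6` AND RANK `≥ 8`, MODULO THE TWO IN–OUT
INEQUALITIES AT NULLITY 5**: `(n − 6)·P_6 ≤ 7·P_7` (§63). -/
theorem biIndep_step_six_of_nullity_six_of_inout (h₁ : InOutBottomFive α) (h₂ : InOutPairBottomFive α)
    (hn : (gr N).card = rk N (gr N) + 6) (hR : 8 ≤ rk N (gr N)) :
    ((gr N).card - 6) * (biIndepSets N 6).card ≤ 7 * (biIndepSets N 7).card := by
  rw [← sum_outCount, ← sum_inCount]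
  exact sum_le_sum (fun x hx => outCount_six_le_inCount_seven_of_nullity_six_of_inout h₁ h₂ hn hR hx)

/-- `(I_{ρ−1})` at co-rank `7` on `#E = ρ(E) + 6` from the step alone (the body of
`thresholdIneq_of_card_eq_of_unimodal` with the single instance `biIndep_step_six_of_nullity_six_of_inout`). -/
theorem thresholdIneq_seven_top_of_card_eq_of_inout (h₁ : InOutBottomFive α) (h₂ : InOutPairBottomFive α)
    (hn : (gr N).card = rk N (gr N) + 6) (hR : 8 ≤ rk N (gr N)) :
    ThresholdIneq N 7 (rk N (gr N) - 1) := by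
  have hn' : (gr N).card = (rk N (gr N) - 1) + 7 := by omega
  unfold ThresholdIneq
  rw [thresholdSum_of_card_eq hn' (by norm_num), levelSetCoQ_eq_biIndepSets_of_card_eq hn']
  have h := biIndep_step_six_of_nullity_six_of_inout h₁ h₂ hn hR
  have e1 : (gr N).card - 6 = (rk N (gr N) - 1) + 1 := by omega
  rw [e1] at h
  exact h

/-- **THE CO-RANK-7 TOP THRESHOLD ON EVERY FINITE MATROID WITH AT MOST SIX MORE POINTS THAN ITS RANK (RANK `≥ 7`),
MODULO THE TWO PER-SET IN–OUT INEQUALITIES AT THE BOTTOM OF NULLITY 5** (`InOutBottomFive`, `InOutPairBottomFive`;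
§63): nullity `≤ 5` is vacuous, rank `7` is the trivial row, nullity `6` at rank `≥ 8` is
`biIndep_step_six_of_nullity_six_of_inout`.  The classes `#C = 2` and `#C = 3` of the nullity-6 per-circuit claim
are the only ones not proved outright; everything else is unconditional. -/
theorem thresholdIneq_seven_top_of_nullity_le_six_of_inout (h₁ : InOutBottomFive α) (h₂ : InOutPairBottomFive α)
    (hn : (gr N).card ≤ rk N (gr N) + 6) (hR : 7 ≤ rk N (gr N)) :
    ThresholdIneq N 7 (rk N (gr N) - 1) := by
  by_cases hlow : (gr N).card + 2 ≤ rk N (gr N) + 7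
  · exact thresholdIneq_top_of_card_add_two_le (by norm_num) hlow
  · by_cases hRq : rk N (gr N) = 7
    · exact thresholdIneq_top_of_rk_eq (by norm_num) hRq
    · exact thresholdIneq_seven_top_of_card_eq_of_inout h₁ h₂ (by omega) (by omega)

end SixTop

end PercRepro.Cogirth
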